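import Mathlib
import HarnessLib
import Summits.HubbardSuperconductivity.HubbardSuperconductivity.Theorems.KLProgrammeKLRegimeEngineLastStepAliasRowsCore
import Summits.HubbardSuperconductivity.HubbardSuperconductivity.Theorems.KLProgrammeKLRegimeEngineLastRespSymbolSupsFlow
import Literature.Analysis.FunctionSpaces.TorusLatticeWeightSumBound

/-!
# K3 gen-8-FLOW (stmt 20437, stub (C), located item #20, cure (δ′) «LAST-STEP SWAP», layer F3g‴): THE LAST-STEP ALIAS ROWS, LITERAL —
# `AL_a j`, `AL_b j`, `AL_c j` of `lastResponse_bracket_flow_sharp_env` at `Mg = 26` are `O(U³/β²)·lʲ` at the REGISTERED volume door `klEngL₄ P R β U ≤ L`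

Cell gate-hubbard-kl, seat p2 g20 («(δ′)-ALIAS-ROWS», step 3).  With the symbol rows of `…ResponseBracketFlowSharpEnv` instantiated at their explicit
Gevrey-2 values (`Dg_X := EXPR_X(26)`, `A₀_X := EXPR_X(0)`, closed envelopes `Ξ, Θ` of `…FlowEnvelopeChoice`, `Φ = 1`), the left-hand sides of the alias
rows `hAL_X` are explicit functions of `(R, W, U, β, L, s, j)` (and of the moments `Mm_X j`, `Ms_X` for `X = b, c`).  This file bounds them:

* §1 the law at the last step: `lastAliasLaw` (`ρ·(2/N) ≤ U/(2^26β)`, `ρ ≤ 2^22·E·β²`, `E ≤ 2^11·klEngRsq R` for any `ρ ≤ 2^31·E·16^m`, `E = (4+Ξ)+1`,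
  at `klEngL4Real ≤ L`, door `1/128`), `four_le_of_klEngL4Real_le`, `aliasS_le` (`2²Σ'_{k∈ℤ²}Π(1+kᵢ²)⁻¹ ≤ 81`), `aliasR_le_one` (`2/N ≤ 1`);
* §2 **`lastAliasRowA_le`**: `AL_a`-LHS `≤ klEngRsq R⁸·U³/(2^17·β²)` (every `j ≤ 4`, `10 ≤ s`), `lastAliasRowA_nonneg`;
* §3 **`lastAliasRowB_le`**: `AL_b`-LHS (moment factors `Mm`, `Ms ≥ 0` abstract) `≤ Mm·(klEngRsq R⁸U¹⁸/(2⁶β²)) + Ms·(U⁴/(2^217β¹²))`, `lastAliasRowB_nonneg`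
  (channel `c` is the same statement with `Mm_c, Ms_c`).

Inputs: `hR`, `0 < Gfr₀`, `0 ≤ W`, `klBetaMin ≤ β`, `0 < U ≤ 1`, `Ξ/Θ` by their defining equations, the `U`-door `Gfr₀|U| + (Σ_{j<5}Gfr_j + π⁸W/2^{11})U² ≤ 1/512`,
`klEngL₄ P R β U ≤ L`.  Proofs = the abstract lemmas of `…LastStepAliasRowsCore` at the literal pieces.  No definitions; nothing asserts superconductivity.
References: BGM 2006 §2.3 (2.21)–(2.24), §2.4 (2.36)–(2.42) [cite: BenfattoGiulianiMastropietro2006].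
-/

noncomputable section

namespace Summit.HubbardSuperconductivity.HubbardSuperconductivity.Theorems.EngineV8

set_option linter.dupNamespace false -- summit = problem name (single-conjunct summit), D-0017

open Real Finset Literature.MathematicalPhysics.QuantumLattice Literature.Probability.LatticeModels
open Summit.HubbardSuperconductivity.HubbardSuperconductivity.Theorems.KLRegimeSplit
open Summit.HubbardSuperconductivity.HubbardSuperconductivity.Theorems.DispersionFlow
open Summit.HubbardSuperconductivity.HubbardSuperconductivity.Theorems.KLProgrammeLegKernels
open scoped Nat

/-! ## §1 The law at the last step and the small geometric facts -/

/-- **The alias law at the last step, variable envelope**: for `Ξ` the closed envelope (by its defining equation), any `ρ ≤ 2^31·((4+Ξ)+1)·16^m` obeys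
`ρ·(2/N) ≤ U/(2^26β)`, `ρ ≤ 2^22·((4+Ξ)+1)·β²`, and `0 ≤ (4+Ξ)+1 ≤ 2^11·klEngRsq R` (door `1/128`, `klEngL4Real ≤ L`, `m ≤ n_β+1`).
[cite: BenfattoGiulianiMastropietro2006, §2.3 (2.24)] -/
theorem lastAliasLaw {P : SplitConsts} {R : RenConsts} (hR : ∀ j, 0 ≤ R.Gfr j) {W : ℝ} (hW : 0 ≤ W) {β U Ξ : ℝ} (hβ : klBetaMin ≤ β) (hU : 0 < U)
    (hΞ : Ξ = (2 ^ 10 * (1 + Real.pi ^ 8 * (W * U ^ 2) / 2 ^ 11) + ∑ j ∈ range 5, R.Gfr j))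
    (hdoor : R.Gfr 0 * |U| + ((∑ j ∈ range 5, R.Gfr j) + Real.pi ^ 8 * W / 2 ^ 11) * U ^ 2 ≤ 1 / 128) {L : ℕ} (hL : klEngL4Real P R β U ≤ L)
    {m : ℕ} (hm : m ≤ nScales β + 1) {ρ : ℝ} (hρ : ρ ≤ 2 ^ 31 * ((4 + Ξ) + 1) * (16 : ℝ) ^ m) :
    ρ * (2 / ((2 * (L / 4 + 1) : ℕ) : ℝ)) ≤ U / (2 ^ 26 * β) ∧ ρ ≤ 2 ^ 22 * ((4 + Ξ) + 1) * β ^ 2 ∧ 0 ≤ (4 + Ξ) + 1 ∧ (4 + Ξ) + 1 ≤ 2 ^ 11 * klEngRsq R := by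
  subst hΞ
  have hE0 : 0 ≤ (4 + (2 ^ 10 * (1 + Real.pi ^ 8 * (W * U ^ 2) / 2 ^ 11) + ∑ j ∈ range 5, R.Gfr j)) + 1 := by
    have := Xi_nonneg hR hW U; linarith
  exact ⟨aliasRatio_mul_two_div_le_closed (P := P) hR hW hβ hU hdoor hL hm hρ, aliasRatio_le_sq_beta hβ hm hE0 hρ, hE0, envelopeE_le hR hdoor⟩

/-- `klEngL4Real P R β U ≤ L ⇒ 4 ≤ L` (`klEngL4Real ≥ 2^61·128³` for `U ≤ 1`, `β ≥ 128`). -/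
theorem four_le_of_klEngL4Real_le {P : SplitConsts} {R : RenConsts} {β U : ℝ} (hβ : klBetaMin ≤ β) (hU : 0 < U) (hU1 : U ≤ 1) {L : ℕ}
    (hL : klEngL4Real P R β U ≤ L) : 4 ≤ L := by
  have h128 : (128 : ℝ) ≤ β := by simpa [klBetaMin] using hβ
  have hP1 := one_le_klEngPsq P
  have hR1 := one_le_klEngRsq R
  have hPR : 1 ≤ klEngPsq P ^ 2 * klEngRsq R ^ 2 := one_le_mul_of_one_le_of_one_le (one_le_pow₀ hP1) (one_le_pow₀ hR1)
  have hβ3 : (1 : ℝ) ≤ β ^ 3 := one_le_pow₀ (by linarith)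
  have h4 : (4 : ℝ) ≤ klEngL4Real P R β U := by
    unfold klEngL4Real
    rw [le_div_iff₀ hU]
    nlinarith [mul_le_mul hPR hβ3 zero_le_one (zero_le_one.trans hPR)]
  exact_mod_cast h4.trans hL

/-- `2²·Σ'_{k∈ℤ²}Π(1+kᵢ²)⁻¹ ≤ 81` and `≥ 0`. -/
theorem aliasS_le : (2 ^ 2 * ∑' k : Fin 2 → ℤ, ∏ i, (1 + (k i : ℝ) ^ 2)⁻¹) ≤ 81 ∧ 0 ≤ (2 ^ 2 * ∑' k : Fin 2 → ℤ, ∏ i, (1 + (k i : ℝ) ^ 2)⁻¹) := by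
  have h := Literature.Analysis.FunctionSpaces.Torus.tsum_prod_inv_one_add_sq_fin_two_le
  have h0 : 0 ≤ ∑' k : Fin 2 → ℤ, ∏ i, (1 + (k i : ℝ) ^ 2)⁻¹ := tsum_nonneg fun k => prod_nonneg fun i _ => by positivity
  constructor <;> linarith

/-- `0 ≤ 2/N ≤ 1` for `N = 2(⌊L/4⌋+1)`. -/
theorem aliasR_le_one (L : ℕ) : (2 / ((2 * (L / 4 + 1) : ℕ) : ℝ)) ≤ 1 ∧ 0 ≤ (2 / ((2 * (L / 4 + 1) : ℕ) : ℝ)) := by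
  have hN : (2 : ℝ) ≤ ((2 * (L / 4 + 1) : ℕ) : ℝ) := by
    have : 2 ≤ 2 * (L / 4 + 1) := by omega
    exact_mod_cast this
  refine ⟨?_, by positivity⟩
  rw [div_le_one (by linarith)]
  exact hN

section Rows

variable {P : SplitConsts} {R : RenConsts} (hR : ∀ j, 0 ≤ R.Gfr j) (hR0 : 0 < R.Gfr 0) {W : ℝ} (hW : 0 ≤ W) {β U : ℝ} (hβ : klBetaMin ≤ β)
  (hU : 0 < U) (hU1 : U ≤ 1) {Ξ Θ : ℝ}
  (hΞ : Ξ = (2 ^ 10 * (1 + Real.pi ^ 8 * (W * U ^ 2) / 2 ^ 11) + ∑ j ∈ range 5, R.Gfr j))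
  (hΘ : Θ = (1 + ((∑ j ∈ range 5, R.Gfr j) + Real.pi ^ 8 * W / 2 ^ 11) * |U| / R.Gfr 0))
  (hdoor : R.Gfr 0 * |U| + ((∑ j ∈ range 5, R.Gfr j) + Real.pi ^ 8 * W / 2 ^ 11) * U ^ 2 ≤ 1 / 512) {L : ℕ} [NeZero L] (hL : klEngL₄ P R β U ≤ L)
  {s : ℕ} (hs : 10 ≤ s) {j : ℕ} (hj : j ≤ 4)
include hR hR0 hW hβ hU hU1 hΞ hΘ hdoor hL hs hj

/-! ## §2 Channel `a` -/

/-- **The channel-`a` alias row at `Mg = 26`**: the LHS of `hALa j` with `Dga := EXPR_a(26)`, `A₀a := EXPR_a(0)` is `≤ klEngRsq R⁸·U³/(2^17·β²)`.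
[cite: BenfattoGiulianiMastropietro2006, §2.3 (2.24)] -/
theorem lastAliasRowA_le :
    2 * (2 * (1 * ((3 : ℝ) ^ j * (((R.Gfr 0 * |U| * Θ * ((16 : ℝ) ^ nScales β)⁻¹) * (R.Gfr 0 * |U| * Θ * ((16 : ℝ) ^ nScales β)⁻¹) / |(β * (L : ℝ) ^ 2)|) * ((5 : ℝ) * (|(β * (L : ℝ)
      ^ 2)| * (6 / (klScale klE0 (nScales β + 1))))) * ((26 ! : ℝ)) ^ 2 * (2 * (2 * (2 ^ 10 * (1 : ℝ) * (4 : ℝ) ^ nScales β) + 2 * (4 * (2 * (4 * (4 + (4 : ℝ) ^ nScales β * Ξ) * (1 +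
      16 * (1 + (27 / 10 : ℝ)) / (klScale klE0 (nScales β + 1)) * 1) + (2 ^ 10 * (1 : ℝ) * (4 : ℝ) ^ nScales β))) * (1 + 6 / (klScale klE0 (nScales β + 1)) * ((klScale klE0 (nScales β
      + 1)) / 128 + (5 : ℝ) * (R.Gfr 0 * |U| * Θ * ((16 : ℝ) ^ nScales β)⁻¹)))))) ^ 26) * (2 / ((2 * (L / 4 + 1) : ℕ) : ℝ)) ^ (26 - j - 4) * (2 ^ 2 * ∑' k : Fin 2 → ℤ, ∏ i, (1 + (k i :
      ℝ) ^ 2)⁻¹)))) + (L : ℝ) ^ 2 * (L : ℝ) ^ j * ((((R.Gfr 0 * |U| * Θ * ((16 : ℝ) ^ nScales β)⁻¹) * (R.Gfr 0 * |U| * Θ * ((16 : ℝ) ^ nScales β)⁻¹) / |(β * (L : ℝ) ^ 2)|) * ((5 : ℝ) *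
      (|(β * (L : ℝ) ^ 2)| * (6 / (klScale klE0 (nScales β + 1))))) * ((0 ! : ℝ)) ^ 2 * (2 * (2 * (2 ^ 10 * (1 : ℝ) * (4 : ℝ) ^ nScales β) + 2 * (4 * (2 * (4 * (4 + (4 : ℝ) ^ nScales β
      * Ξ) * (1 + 16 * (1 + (27 / 10 : ℝ)) / (klScale klE0 (nScales β + 1)) * 1) + (2 ^ 10 * (1 : ℝ) * (4 : ℝ) ^ nScales β))) * (1 + 6 / (klScale klE0 (nScales β + 1)) * ((klScale klE0
      (nScales β + 1)) / 128 + (5 : ℝ) * (R.Gfr 0 * |U| * Θ * ((16 : ℝ) ^ nScales β)⁻¹)))))) ^ 0) * (1 / (1 + (L : ℝ) / 4) ^ s)) ≤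
      klEngRsq R ^ 8 * U ^ 3 / (2 ^ 17 * β ^ 2) := by
  have h128 : (128 : ℝ) ≤ β := by simpa [klBetaMin] using hβ
  have hβ0 : (0 : ℝ) < β := by linarith
  have hLr := klEngL4Real_le_of_klEngL₄_le hL
  have hL4 := four_le_of_klEngL4Real_le hβ hU hU1 hLr
  have hPR : 1 ≤ klEngPsq P ^ 2 * klEngRsq R ^ 2 := one_le_mul_of_one_le_of_one_le (one_le_pow₀ (one_le_klEngPsq P)) (one_le_pow₀ (one_le_klEngRsq R))
  have hX : U / (2 ^ 59 * klEngPsq P ^ 2 * klEngRsq R ^ 2 * β ^ 3) ≤ U / (2 ^ 59 * β ^ 3) := by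
    refine div_le_div_of_nonneg_left hU.le (by positivity) ?_
    nlinarith [pow_pos hβ0 3]
  have hX0 : 0 ≤ U / (2 ^ 59 * klEngPsq P ^ 2 * klEngRsq R ^ 2 * β ^ 3) := by
    have hPRp : 0 < klEngPsq P ^ 2 * klEngRsq R ^ 2 := mul_pos (pow_pos (klEngPsq_pos P) 2) (pow_pos (klEngRsq_pos R) 2)
    have hden : 0 < 2 ^ 59 * klEngPsq P ^ 2 * klEngRsq R ^ 2 * β ^ 3 := by
      have := mul_pos (mul_pos hPRp (pow_pos hβ0 3)) (by norm_num : (0 : ℝ) < 2 ^ 59); linarith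
    exact div_nonneg hU.le hden.le
  have hU1' : |U| ≤ 1 := by rw [abs_of_pos hU]; exact hU1
  have hΞ0 : 0 ≤ Ξ := by rw [hΞ]; exact Xi_nonneg hR hW U
  have hΘ0 : 0 ≤ Θ := by rw [hΘ]; exact Theta_nonneg hR hR0 hW U
  have hδΛ : R.Gfr 0 * |U| * Θ * ((16 : ℝ) ^ nScales β)⁻¹ ≤ klScale klE0 (nScales β + 1) / 4 := by
    rw [hΘ]; exact Gfr_mul_Theta_inv_pow_le_klScale_succ_div_four hR0 hdoor (nScales β)
  have hT : R.Gfr 0 * |U| * Θ ≤ 1 / 512 := by rw [hΘ, Gfr_mul_abs_mul_Theta_eq hR0]; exact hdoor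
  have hc : (β * (L : ℝ) ^ 2) ≠ 0 := by
    have hL1 : (1 : ℝ) ≤ L := by exact_mod_cast Nat.one_le_iff_ne_zero.2 (NeZero.ne L)
    positivity
  obtain ⟨hPa, hPa0⟩ := lastPrefA_le (c := (β * (L : ℝ) ^ 2)) (hR 0) hc hΘ0 (nScales β) hδΛ hT
  have hρ := lastRatio₃_le (hR 0) hΞ0 hΘ0 zero_le_one (nScales β) hδΛ (U := U)
  have hρ0 := lastRatio₃_nonneg (hR 0) hΞ0 hΘ0 zero_le_one (nScales β) hδΛ (U := U)
  obtain ⟨hρr, hρB, hE0, hE⟩ := lastAliasLaw (P := P) hR hW hβ hU hΞ (hdoor.trans (by norm_num)) hLr (Nat.le_succ _) hρ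
  have hQ := gevreyRow26_le (R := R) (U := U) hβ hE0 hE
  obtain ⟨hS, hS0⟩ := aliasS_le
  obtain ⟨hr1, hr0⟩ := aliasR_le_one L
  have halias := aliasPartA_le hj hPa0 hPa hρ0 hr0 hr1 hρr hρB hS0 hS hQ
  have h4L := four_div_le_of_klEngL4Real_le (P := P) (R := R) hU hβ0 hLr
  have hfar := farPartA_le hL4 hPa0 hPa hj hs h4L
    (ρ := (2 * (2 * (2 ^ 10 * (1 : ℝ) * (4 : ℝ) ^ nScales β) + 2 * (4 * (2 * (4 * (4 + (4 : ℝ) ^ nScales β * Ξ) * (1 + 16 * (1 + (27 / 10 : ℝ)) / (klScale klE0 (nScales β + 1)) * 1) + (2 ^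
      10 * (1 : ℝ) * (4 : ℝ) ^ nScales β))) * (1 + 6 / (klScale klE0 (nScales β + 1)) * ((klScale klE0 (nScales β + 1)) / 128 + (5 : ℝ) * (R.Gfr 0 * |U| * Θ * ((16 : ℝ) ^ nScales
      β)⁻¹)))))))
  have hrow := rowBoundA_le (one_le_klEngRsq R) hU.le hU1 h128 hX0 hX
  exact (add_le_add halias hfar).trans hrow

omit hU hU1 hL hs hj in
/-- `0 ≤` the channel-`a` alias-row LHS. -/
theorem lastAliasRowA_nonneg :
    0 ≤ 2 * (2 * (1 * ((3 : ℝ) ^ j * (((R.Gfr 0 * |U| * Θ * ((16 : ℝ) ^ nScales β)⁻¹) * (R.Gfr 0 * |U| * Θ * ((16 : ℝ) ^ nScales β)⁻¹) / |(β * (L : ℝ) ^ 2)|) * ((5 : ℝ) * (|(β * (L : ℝ)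
      ^ 2)| * (6 / (klScale klE0 (nScales β + 1))))) * ((26 ! : ℝ)) ^ 2 * (2 * (2 * (2 ^ 10 * (1 : ℝ) * (4 : ℝ) ^ nScales β) + 2 * (4 * (2 * (4 * (4 + (4 : ℝ) ^ nScales β * Ξ) * (1 +
      16 * (1 + (27 / 10 : ℝ)) / (klScale klE0 (nScales β + 1)) * 1) + (2 ^ 10 * (1 : ℝ) * (4 : ℝ) ^ nScales β))) * (1 + 6 / (klScale klE0 (nScales β + 1)) * ((klScale klE0 (nScales β
      + 1)) / 128 + (5 : ℝ) * (R.Gfr 0 * |U| * Θ * ((16 : ℝ) ^ nScales β)⁻¹)))))) ^ 26) * (2 / ((2 * (L / 4 + 1) : ℕ) : ℝ)) ^ (26 - j - 4) * (2 ^ 2 * ∑' k : Fin 2 → ℤ, ∏ i, (1 + (k i :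
      ℝ) ^ 2)⁻¹)))) + (L : ℝ) ^ 2 * (L : ℝ) ^ j * ((((R.Gfr 0 * |U| * Θ * ((16 : ℝ) ^ nScales β)⁻¹) * (R.Gfr 0 * |U| * Θ * ((16 : ℝ) ^ nScales β)⁻¹) / |(β * (L : ℝ) ^ 2)|) * ((5 : ℝ) *
      (|(β * (L : ℝ) ^ 2)| * (6 / (klScale klE0 (nScales β + 1))))) * ((0 ! : ℝ)) ^ 2 * (2 * (2 * (2 ^ 10 * (1 : ℝ) * (4 : ℝ) ^ nScales β) + 2 * (4 * (2 * (4 * (4 + (4 : ℝ) ^ nScales β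
      * Ξ) * (1 + 16 * (1 + (27 / 10 : ℝ)) / (klScale klE0 (nScales β + 1)) * 1) + (2 ^ 10 * (1 : ℝ) * (4 : ℝ) ^ nScales β))) * (1 + 6 / (klScale klE0 (nScales β + 1)) * ((klScale klE0
      (nScales β + 1)) / 128 + (5 : ℝ) * (R.Gfr 0 * |U| * Θ * ((16 : ℝ) ^ nScales β)⁻¹)))))) ^ 0) * (1 / (1 + (L : ℝ) / 4) ^ s)) := by
  have h128 : (128 : ℝ) ≤ β := by simpa [klBetaMin] using hβ
  have hΞ0 : 0 ≤ Ξ := by rw [hΞ]; exact Xi_nonneg hR hW U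
  have hΘ0 : 0 ≤ Θ := by rw [hΘ]; exact Theta_nonneg hR hR0 hW U
  have hδΛ : R.Gfr 0 * |U| * Θ * ((16 : ℝ) ^ nScales β)⁻¹ ≤ klScale klE0 (nScales β + 1) / 4 := by
    rw [hΘ]; exact Gfr_mul_Theta_inv_pow_le_klScale_succ_div_four hR0 hdoor (nScales β)
  have hT : R.Gfr 0 * |U| * Θ ≤ 1 / 512 := by rw [hΘ, Gfr_mul_abs_mul_Theta_eq hR0]; exact hdoor
  have hc : (β * (L : ℝ) ^ 2) ≠ 0 := by
    have hβ0 : (0 : ℝ) < β := by linarith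
    have hL1 : (1 : ℝ) ≤ L := by exact_mod_cast Nat.one_le_iff_ne_zero.2 (NeZero.ne L)
    positivity
  obtain ⟨-, hPa0⟩ := lastPrefA_le (c := (β * (L : ℝ) ^ 2)) (hR 0) hc hΘ0 (nScales β) hδΛ hT
  have hρ0 := lastRatio₃_nonneg (hR 0) hΞ0 hΘ0 zero_le_one (nScales β) hδΛ (U := U)
  obtain ⟨-, hS0⟩ := aliasS_le
  obtain ⟨-, hr0⟩ := aliasR_le_one L
  have h1 := aliasPartA_nonneg j hPa0 hr0 hS0 (ρ := (2 * (2 * (2 ^ 10 * (1 : ℝ) * (4 : ℝ) ^ nScales β) + 2 * (4 * (2 * (4 * (4 + (4 : ℝ) ^ nScales β * Ξ) * (1 + 16 * (1 + (27 / 10 : ℝ)) / (klScale klE0 (nScales β + 1)) * 1) + (2 ^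
      10 * (1 : ℝ) * (4 : ℝ) ^ nScales β))) * (1 + 6 / (klScale klE0 (nScales β + 1)) * ((klScale klE0 (nScales β + 1)) / 128 + (5 : ℝ) * (R.Gfr 0 * |U| * Θ * ((16 : ℝ) ^ nScales
      β)⁻¹)))))))
  have h2 := farPartA_nonneg L hPa0 j s (ρ := (2 * (2 * (2 ^ 10 * (1 : ℝ) * (4 : ℝ) ^ nScales β) + 2 * (4 * (2 * (4 * (4 + (4 : ℝ) ^ nScales β * Ξ) * (1 + 16 * (1 + (27 / 10 : ℝ)) / (klScale klE0 (nScales β + 1)) * 1) + (2 ^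
      10 * (1 : ℝ) * (4 : ℝ) ^ nScales β))) * (1 + 6 / (klScale klE0 (nScales β + 1)) * ((klScale klE0 (nScales β + 1)) / 128 + (5 : ℝ) * (R.Gfr 0 * |U| * Θ * ((16 : ℝ) ^ nScales
      β)⁻¹)))))))
  exact add_nonneg h1 h2

/-! ## §3 Channels `b` and `c` -/

/-- **The channel-`b`/`c` alias row at `Mg = 26`**: the LHS of `hALb j` (resp. `hALc j`) with `Dgb := EXPR_b(26)`, `A₀b := EXPR_b(0)`, the moment factors
`Mm := Mm_b j ≥ 0`, `Ms := Ms_b ≥ 0` abstract, is `≤ Mm·(klEngRsq R⁸U¹⁸/(2⁶β²)) + Ms·(U⁴/(2^217β¹²))`. [cite: BenfattoGiulianiMastropietro2006, §2.3 (2.24)] -/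
theorem lastAliasRowB_le {Mm Ms : ℝ} (hMm : 0 ≤ Mm) (hMs : 0 ≤ Ms) :
    2 * (2 * (Mm * ((3 : ℝ) ^ j * (((R.Gfr 0 * |U| * Θ * ((16 : ℝ) ^ nScales β)⁻¹) / |(β * (L : ℝ) ^ 2)| * ((5 : ℝ) * (|(β * (L : ℝ) ^ 2)| * (6 / (klScale klE0 (nScales β + 1)))))) *
      ((R.Gfr 0 * |U| * Θ * ((16 : ℝ) ^ nScales β)⁻¹) / |(β * (L : ℝ) ^ 2)| * ((5 : ℝ) * (|(β * (L : ℝ) ^ 2)| * (6 / (klScale klE0 (nScales β + 1)))))) * ((26 ! : ℝ)) ^ 2 * (2 * (2 *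
      (2 * (2 ^ 10 * (1 : ℝ) * (4 : ℝ) ^ nScales β) + 2 * (4 * (2 * (4 * (4 + (4 : ℝ) ^ nScales β * Ξ) * (1 + 16 * (1 + (27 / 10 : ℝ)) / (klScale klE0 (nScales β + 1)) * 1) + (2 ^ 10 *
      (1 : ℝ) * (4 : ℝ) ^ nScales β))) * (1 + 6 / (klScale klE0 (nScales β + 1)) * ((klScale klE0 (nScales β + 1)) / 128 + (5 : ℝ) * (R.Gfr 0 * |U| * Θ * ((16 : ℝ) ^ nScales
      β)⁻¹))))))) ^ 26 + 2 * (((R.Gfr 0 * |U| * Θ * ((16 : ℝ) ^ nScales β)⁻¹) / |(β * (L : ℝ) ^ 2)|) * ((5 : ℝ) * (|(β * (L : ℝ) ^ 2)| * (6 / (klScale klE0 (nScales β + 1))))) * ((26 !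
      : ℝ)) ^ 2 * (2 * (2 * (2 ^ 10 * (1 : ℝ) * (4 : ℝ) ^ nScales β) + 2 * (4 * (2 * (4 * (4 + (4 : ℝ) ^ nScales β * Ξ) * (1 + 16 * (1 + (27 / 10 : ℝ)) / (klScale klE0 (nScales β + 1))
      * 1) + (2 ^ 10 * (1 : ℝ) * (4 : ℝ) ^ nScales β))) * (1 + 6 / (klScale klE0 (nScales β + 1)) * ((klScale klE0 (nScales β + 1)) / 128 + (5 : ℝ) * (R.Gfr 0 * |U| * Θ * ((16 : ℝ) ^
      nScales β)⁻¹)))))) ^ 26)) * (2 / ((2 * (L / 4 + 1) : ℕ) : ℝ)) ^ (26 - j - 4) * (2 ^ 2 * ∑' k : Fin 2 → ℤ, ∏ i, (1 + (k i : ℝ) ^ 2)⁻¹)))) + (L : ℝ) ^ 2 * (L : ℝ) ^ j * ((((R.Gfr 0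
      * |U| * Θ * ((16 : ℝ) ^ nScales β)⁻¹) / |(β * (L : ℝ) ^ 2)| * ((5 : ℝ) * (|(β * (L : ℝ) ^ 2)| * (6 / (klScale klE0 (nScales β + 1)))))) * ((R.Gfr 0 * |U| * Θ * ((16 : ℝ) ^
      nScales β)⁻¹) / |(β * (L : ℝ) ^ 2)| * ((5 : ℝ) * (|(β * (L : ℝ) ^ 2)| * (6 / (klScale klE0 (nScales β + 1)))))) * ((0 ! : ℝ)) ^ 2 * (2 * (2 * (2 * (2 ^ 10 * (1 : ℝ) * (4 : ℝ) ^
      nScales β) + 2 * (4 * (2 * (4 * (4 + (4 : ℝ) ^ nScales β * Ξ) * (1 + 16 * (1 + (27 / 10 : ℝ)) / (klScale klE0 (nScales β + 1)) * 1) + (2 ^ 10 * (1 : ℝ) * (4 : ℝ) ^ nScales β))) *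
      (1 + 6 / (klScale klE0 (nScales β + 1)) * ((klScale klE0 (nScales β + 1)) / 128 + (5 : ℝ) * (R.Gfr 0 * |U| * Θ * ((16 : ℝ) ^ nScales β)⁻¹))))))) ^ 0 + 2 * (((R.Gfr 0 * |U| * Θ *
      ((16 : ℝ) ^ nScales β)⁻¹) / |(β * (L : ℝ) ^ 2)|) * ((5 : ℝ) * (|(β * (L : ℝ) ^ 2)| * (6 / (klScale klE0 (nScales β + 1))))) * ((0 ! : ℝ)) ^ 2 * (2 * (2 * (2 ^ 10 * (1 : ℝ) * (4 :
      ℝ) ^ nScales β) + 2 * (4 * (2 * (4 * (4 + (4 : ℝ) ^ nScales β * Ξ) * (1 + 16 * (1 + (27 / 10 : ℝ)) / (klScale klE0 (nScales β + 1)) * 1) + (2 ^ 10 * (1 : ℝ) * (4 : ℝ) ^ nScales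
      β))) * (1 + 6 / (klScale klE0 (nScales β + 1)) * ((klScale klE0 (nScales β + 1)) / 128 + (5 : ℝ) * (R.Gfr 0 * |U| * Θ * ((16 : ℝ) ^ nScales β)⁻¹)))))) ^ 0)) * (Ms / (1 + (L : ℝ)
      / 4) ^ s)) ≤
      Mm * (klEngRsq R ^ 8 * U ^ 18 / (2 ^ 6 * β ^ 2)) + Ms * (U ^ 4 / (2 ^ 217 * β ^ 12)) := by
  have h128 : (128 : ℝ) ≤ β := by simpa [klBetaMin] using hβ
  have hβ0 : (0 : ℝ) < β := by linarith
  have hLr := klEngL4Real_le_of_klEngL₄_le hL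
  have hL4 := four_le_of_klEngL4Real_le hβ hU hU1 hLr
  have hPR : 1 ≤ klEngPsq P ^ 2 * klEngRsq R ^ 2 := one_le_mul_of_one_le_of_one_le (one_le_pow₀ (one_le_klEngPsq P)) (one_le_pow₀ (one_le_klEngRsq R))
  have hX : U / (2 ^ 59 * klEngPsq P ^ 2 * klEngRsq R ^ 2 * β ^ 3) ≤ U / (2 ^ 59 * β ^ 3) := by
    refine div_le_div_of_nonneg_left hU.le (by positivity) ?_
    nlinarith [pow_pos hβ0 3]
  have hX0 : 0 ≤ U / (2 ^ 59 * klEngPsq P ^ 2 * klEngRsq R ^ 2 * β ^ 3) := by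
    have hPRp : 0 < klEngPsq P ^ 2 * klEngRsq R ^ 2 := mul_pos (pow_pos (klEngPsq_pos P) 2) (pow_pos (klEngRsq_pos R) 2)
    have hden : 0 < 2 ^ 59 * klEngPsq P ^ 2 * klEngRsq R ^ 2 * β ^ 3 := by
      have := mul_pos (mul_pos hPRp (pow_pos hβ0 3)) (by norm_num : (0 : ℝ) < 2 ^ 59); linarith
    exact div_nonneg hU.le hden.le
  have hΞ0 : 0 ≤ Ξ := by rw [hΞ]; exact Xi_nonneg hR hW U
  have hΘ0 : 0 ≤ Θ := by rw [hΘ]; exact Theta_nonneg hR hR0 hW U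
  have hδΛ : R.Gfr 0 * |U| * Θ * ((16 : ℝ) ^ nScales β)⁻¹ ≤ klScale klE0 (nScales β + 1) / 4 := by
    rw [hΘ]; exact Gfr_mul_Theta_inv_pow_le_klScale_succ_div_four hR0 hdoor (nScales β)
  have hc : (β * (L : ℝ) ^ 2) ≠ 0 := by
    have hL1 : (1 : ℝ) ≤ L := by exact_mod_cast Nat.one_le_iff_ne_zero.2 (NeZero.ne L)
    positivity
  obtain ⟨hPb, hPb0⟩ := lastPrefB_le (c := (β * (L : ℝ) ^ 2)) (hR 0) hc hΘ0 (nScales β) hδΛ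
  have hρ3 := lastRatio₃_le (hR 0) hΞ0 hΘ0 zero_le_one (nScales β) hδΛ (U := U)
  have hρ30 := lastRatio₃_nonneg (hR 0) hΞ0 hΘ0 zero_le_one (nScales β) hδΛ (U := U)
  have hρ4 := lastRatio₄_le (hR 0) hΞ0 hΘ0 zero_le_one (nScales β) hδΛ (U := U)
  have hρ40 : 0 ≤ 2 * (2 * (2 * (2 ^ 10 * (1 : ℝ) * (4 : ℝ) ^ nScales β) + 2 * (4 * (2 * (4 * (4 + (4 : ℝ) ^ nScales β * Ξ) * (1 + 16 * (1 + (27 / 10 : ℝ)) / (klScale klE0 (nScales β + 1)) * 1) + (2 ^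
      10 * (1 : ℝ) * (4 : ℝ) ^ nScales β))) * (1 + 6 / (klScale klE0 (nScales β + 1)) * ((klScale klE0 (nScales β + 1)) / 128 + (5 : ℝ) * (R.Gfr 0 * |U| * Θ * ((16 : ℝ) ^ nScales
      β)⁻¹)))))) := mul_nonneg (by norm_num) hρ30
  obtain ⟨hρ3r, hρ3B, hE0, hE⟩ := lastAliasLaw (P := P) hR hW hβ hU hΞ (hdoor.trans (by norm_num)) hLr (Nat.le_succ _) hρ3
  obtain ⟨hρ4r, hρ4B, -, -⟩ := lastAliasLaw (P := P) hR hW hβ hU hΞ (hdoor.trans (by norm_num)) hLr (Nat.le_succ _) hρ4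
  have hQ := gevreyRow26_le (R := R) (U := U) hβ hE0 hE
  obtain ⟨hS, hS0⟩ := aliasS_le
  obtain ⟨hr1, hr0⟩ := aliasR_le_one L
  have halias := aliasPartB_le hj hPb0 hPb hρ30 hρ40 hr0 hr1 hρ3r hρ3B hρ4r hρ4B hS0 hS hQ hMm
  have h4L := four_div_le_of_klEngL4Real_le (P := P) (R := R) hU hβ0 hLr
  have hfar := farPartB_le hL4 hPb0 hPb hMs hj hs h4L
    (ρ₃ := (2 * (2 * (2 ^ 10 * (1 : ℝ) * (4 : ℝ) ^ nScales β) + 2 * (4 * (2 * (4 * (4 + (4 : ℝ) ^ nScales β * Ξ) * (1 + 16 * (1 + (27 / 10 : ℝ)) / (klScale klE0 (nScales β + 1)) * 1) + (2 ^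
      10 * (1 : ℝ) * (4 : ℝ) ^ nScales β))) * (1 + 6 / (klScale klE0 (nScales β + 1)) * ((klScale klE0 (nScales β + 1)) / 128 + (5 : ℝ) * (R.Gfr 0 * |U| * Θ * ((16 : ℝ) ^ nScales
      β)⁻¹)))))))
    (ρ₄ := 2 * (2 * (2 * (2 ^ 10 * (1 : ℝ) * (4 : ℝ) ^ nScales β) + 2 * (4 * (2 * (4 * (4 + (4 : ℝ) ^ nScales β * Ξ) * (1 + 16 * (1 + (27 / 10 : ℝ)) / (klScale klE0 (nScales β + 1)) * 1) + (2 ^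
      10 * (1 : ℝ) * (4 : ℝ) ^ nScales β))) * (1 + 6 / (klScale klE0 (nScales β + 1)) * ((klScale klE0 (nScales β + 1)) / 128 + (5 : ℝ) * (R.Gfr 0 * |U| * Θ * ((16 : ℝ) ^ nScales
      β)⁻¹)))))))
  have hrow := rowBoundB_le (Rsq := klEngRsq R) (Mm := Mm) (Ms := Ms) h128 hX0 hX hMm hMs
  exact (add_le_add halias hfar).trans hrow

omit hU hU1 hL hs hj in
/-- `0 ≤` the channel-`b`/`c` alias-row LHS. -/
theorem lastAliasRowB_nonneg {Mm Ms : ℝ} (hMm : 0 ≤ Mm) (hMs : 0 ≤ Ms) :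
    0 ≤ 2 * (2 * (Mm * ((3 : ℝ) ^ j * (((R.Gfr 0 * |U| * Θ * ((16 : ℝ) ^ nScales β)⁻¹) / |(β * (L : ℝ) ^ 2)| * ((5 : ℝ) * (|(β * (L : ℝ) ^ 2)| * (6 / (klScale klE0 (nScales β + 1)))))) *
      ((R.Gfr 0 * |U| * Θ * ((16 : ℝ) ^ nScales β)⁻¹) / |(β * (L : ℝ) ^ 2)| * ((5 : ℝ) * (|(β * (L : ℝ) ^ 2)| * (6 / (klScale klE0 (nScales β + 1)))))) * ((26 ! : ℝ)) ^ 2 * (2 * (2 *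
      (2 * (2 ^ 10 * (1 : ℝ) * (4 : ℝ) ^ nScales β) + 2 * (4 * (2 * (4 * (4 + (4 : ℝ) ^ nScales β * Ξ) * (1 + 16 * (1 + (27 / 10 : ℝ)) / (klScale klE0 (nScales β + 1)) * 1) + (2 ^ 10 *
      (1 : ℝ) * (4 : ℝ) ^ nScales β))) * (1 + 6 / (klScale klE0 (nScales β + 1)) * ((klScale klE0 (nScales β + 1)) / 128 + (5 : ℝ) * (R.Gfr 0 * |U| * Θ * ((16 : ℝ) ^ nScales
      β)⁻¹))))))) ^ 26 + 2 * (((R.Gfr 0 * |U| * Θ * ((16 : ℝ) ^ nScales β)⁻¹) / |(β * (L : ℝ) ^ 2)|) * ((5 : ℝ) * (|(β * (L : ℝ) ^ 2)| * (6 / (klScale klE0 (nScales β + 1))))) * ((26 !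
      : ℝ)) ^ 2 * (2 * (2 * (2 ^ 10 * (1 : ℝ) * (4 : ℝ) ^ nScales β) + 2 * (4 * (2 * (4 * (4 + (4 : ℝ) ^ nScales β * Ξ) * (1 + 16 * (1 + (27 / 10 : ℝ)) / (klScale klE0 (nScales β + 1))
      * 1) + (2 ^ 10 * (1 : ℝ) * (4 : ℝ) ^ nScales β))) * (1 + 6 / (klScale klE0 (nScales β + 1)) * ((klScale klE0 (nScales β + 1)) / 128 + (5 : ℝ) * (R.Gfr 0 * |U| * Θ * ((16 : ℝ) ^
      nScales β)⁻¹)))))) ^ 26)) * (2 / ((2 * (L / 4 + 1) : ℕ) : ℝ)) ^ (26 - j - 4) * (2 ^ 2 * ∑' k : Fin 2 → ℤ, ∏ i, (1 + (k i : ℝ) ^ 2)⁻¹)))) + (L : ℝ) ^ 2 * (L : ℝ) ^ j * ((((R.Gfr 0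
      * |U| * Θ * ((16 : ℝ) ^ nScales β)⁻¹) / |(β * (L : ℝ) ^ 2)| * ((5 : ℝ) * (|(β * (L : ℝ) ^ 2)| * (6 / (klScale klE0 (nScales β + 1)))))) * ((R.Gfr 0 * |U| * Θ * ((16 : ℝ) ^
      nScales β)⁻¹) / |(β * (L : ℝ) ^ 2)| * ((5 : ℝ) * (|(β * (L : ℝ) ^ 2)| * (6 / (klScale klE0 (nScales β + 1)))))) * ((0 ! : ℝ)) ^ 2 * (2 * (2 * (2 * (2 ^ 10 * (1 : ℝ) * (4 : ℝ) ^
      nScales β) + 2 * (4 * (2 * (4 * (4 + (4 : ℝ) ^ nScales β * Ξ) * (1 + 16 * (1 + (27 / 10 : ℝ)) / (klScale klE0 (nScales β + 1)) * 1) + (2 ^ 10 * (1 : ℝ) * (4 : ℝ) ^ nScales β))) *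
      (1 + 6 / (klScale klE0 (nScales β + 1)) * ((klScale klE0 (nScales β + 1)) / 128 + (5 : ℝ) * (R.Gfr 0 * |U| * Θ * ((16 : ℝ) ^ nScales β)⁻¹))))))) ^ 0 + 2 * (((R.Gfr 0 * |U| * Θ *
      ((16 : ℝ) ^ nScales β)⁻¹) / |(β * (L : ℝ) ^ 2)|) * ((5 : ℝ) * (|(β * (L : ℝ) ^ 2)| * (6 / (klScale klE0 (nScales β + 1))))) * ((0 ! : ℝ)) ^ 2 * (2 * (2 * (2 ^ 10 * (1 : ℝ) * (4 :
      ℝ) ^ nScales β) + 2 * (4 * (2 * (4 * (4 + (4 : ℝ) ^ nScales β * Ξ) * (1 + 16 * (1 + (27 / 10 : ℝ)) / (klScale klE0 (nScales β + 1)) * 1) + (2 ^ 10 * (1 : ℝ) * (4 : ℝ) ^ nScales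
      β))) * (1 + 6 / (klScale klE0 (nScales β + 1)) * ((klScale klE0 (nScales β + 1)) / 128 + (5 : ℝ) * (R.Gfr 0 * |U| * Θ * ((16 : ℝ) ^ nScales β)⁻¹)))))) ^ 0)) * (Ms / (1 + (L : ℝ)
      / 4) ^ s)) := by
  have h128 : (128 : ℝ) ≤ β := by simpa [klBetaMin] using hβ
  have hΞ0 : 0 ≤ Ξ := by rw [hΞ]; exact Xi_nonneg hR hW U
  have hΘ0 : 0 ≤ Θ := by rw [hΘ]; exact Theta_nonneg hR hR0 hW U
  have hδΛ : R.Gfr 0 * |U| * Θ * ((16 : ℝ) ^ nScales β)⁻¹ ≤ klScale klE0 (nScales β + 1) / 4 := by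
    rw [hΘ]; exact Gfr_mul_Theta_inv_pow_le_klScale_succ_div_four hR0 hdoor (nScales β)
  have hc : (β * (L : ℝ) ^ 2) ≠ 0 := by
    have hβ0 : (0 : ℝ) < β := by linarith
    have hL1 : (1 : ℝ) ≤ L := by exact_mod_cast Nat.one_le_iff_ne_zero.2 (NeZero.ne L)
    positivity
  obtain ⟨-, hPb0⟩ := lastPrefB_le (c := (β * (L : ℝ) ^ 2)) (hR 0) hc hΘ0 (nScales β) hδΛ
  obtain ⟨-, hS0⟩ := aliasS_le
  obtain ⟨-, hr0⟩ := aliasR_le_one L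
  have h1 := aliasPartB_nonneg j hPb0 hr0 hS0 hMm (ρ₃ := (2 * (2 * (2 ^ 10 * (1 : ℝ) * (4 : ℝ) ^ nScales β) + 2 * (4 * (2 * (4 * (4 + (4 : ℝ) ^ nScales β * Ξ) * (1 + 16 * (1 + (27 / 10 : ℝ)) / (klScale klE0 (nScales β + 1)) * 1) + (2 ^
      10 * (1 : ℝ) * (4 : ℝ) ^ nScales β))) * (1 + 6 / (klScale klE0 (nScales β + 1)) * ((klScale klE0 (nScales β + 1)) / 128 + (5 : ℝ) * (R.Gfr 0 * |U| * Θ * ((16 : ℝ) ^ nScales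
      β)⁻¹)))))))
    (ρ₄ := 2 * (2 * (2 * (2 ^ 10 * (1 : ℝ) * (4 : ℝ) ^ nScales β) + 2 * (4 * (2 * (4 * (4 + (4 : ℝ) ^ nScales β * Ξ) * (1 + 16 * (1 + (27 / 10 : ℝ)) / (klScale klE0 (nScales β + 1)) * 1) + (2 ^
      10 * (1 : ℝ) * (4 : ℝ) ^ nScales β))) * (1 + 6 / (klScale klE0 (nScales β + 1)) * ((klScale klE0 (nScales β + 1)) / 128 + (5 : ℝ) * (R.Gfr 0 * |U| * Θ * ((16 : ℝ) ^ nScales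
      β)⁻¹)))))))
  have h2 := farPartB_nonneg L hPb0 hMs j s (ρ₃ := (2 * (2 * (2 ^ 10 * (1 : ℝ) * (4 : ℝ) ^ nScales β) + 2 * (4 * (2 * (4 * (4 + (4 : ℝ) ^ nScales β * Ξ) * (1 + 16 * (1 + (27 / 10 : ℝ)) / (klScale klE0 (nScales β + 1)) * 1) + (2 ^
      10 * (1 : ℝ) * (4 : ℝ) ^ nScales β))) * (1 + 6 / (klScale klE0 (nScales β + 1)) * ((klScale klE0 (nScales β + 1)) / 128 + (5 : ℝ) * (R.Gfr 0 * |U| * Θ * ((16 : ℝ) ^ nScales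
      β)⁻¹)))))))
    (ρ₄ := 2 * (2 * (2 * (2 ^ 10 * (1 : ℝ) * (4 : ℝ) ^ nScales β) + 2 * (4 * (2 * (4 * (4 + (4 : ℝ) ^ nScales β * Ξ) * (1 + 16 * (1 + (27 / 10 : ℝ)) / (klScale klE0 (nScales β + 1)) * 1) + (2 ^
      10 * (1 : ℝ) * (4 : ℝ) ^ nScales β))) * (1 + 6 / (klScale klE0 (nScales β + 1)) * ((klScale klE0 (nScales β + 1)) / 128 + (5 : ℝ) * (R.Gfr 0 * |U| * Θ * ((16 : ℝ) ^ nScales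
      β)⁻¹)))))))
  exact add_nonneg h1 h2

end Rows

end Summit.HubbardSuperconductivity.HubbardSuperconductivity.Theorems.EngineV8

end
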